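import Summits.CriticalPhenomena.PercolationContinuityZ3.Theorems.PercNearOneGluingNoHeavyLowerTailSahiThreeCopyTwoPointCertsK4

/-!
# Sahi's three-function conjecture on `{0,1}^4`, unconditionally

`d = 0` corollaries of the `k = 4` certificate theorem `tc_front4_nonneg_all` (`…SahiThreeCopyTwoPointCertsK4`): with an empty back block the free
slot `frontFn 4 f` is `f` itself, and the finite layer cake in the first slot (`exists_upperSet_decomposition`) removes the restriction to up-set
indicators.  Results: `tc_four_nonneg` — 3C-SAHI for ALL nonnegative monotone triples on `{0,1}^4` — and `sahiPositive_coinWeight_four` — Sahi's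
conjecture `C₃` (Kahn's `E₃ ≥ 0` for three increasing functions of four independent bits) for every product measure on four bits.  (Three bits:
`…SahiThreeCopySmallCubes`.)
-/

namespace Summit.CriticalPhenomena.PercolationContinuityZ3.Theorems.SahiThreeCopy

open Finset Function Literature.Combinatorics.Sahi2008

/-- With an empty back block, `frontFn 4 f` is `f` itself. [this work] -/
theorem frontFn_four_zero (f : Pt 4 → ℝ) : frontFn (d := 0) 4 f = f := by
  funext w
  simp only [frontFn]
  congr 1
  funext i
  fin_cases i <;> rfl

/-- ★★★ **3C-SAHI on `{0,1}^4`, unconditionally**: `0 ≤ c_b(f, g, h)` for every profile `b` and ALL nonnegative monotone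
`f, g, h : {0,1}^4 → ℝ` (finite layer cake in the first slot + `tc_front4_nonneg_all` with an empty back block). [this work] -/
theorem tc_four_nonneg (b : Fin 4 → ℕ) {f g h : Pt 4 → ℝ} (hf : ∀ x, 0 ≤ f x) (hg : ∀ x, 0 ≤ g x) (hh : ∀ x, 0 ≤ h x)
    (hfm : Monotone f) (hgm : Monotone g) (hhm : Monotone h) : 0 ≤ tc b f g h := by
  obtain ⟨l, hl, rfl⟩ := exists_upperSet_decomposition f hf hfm
  clear hf hfm
  induction l with
  | nil => simp only [List.map_nil, List.sum_nil]; have := tc_smul_left b 0 0 g h; rw [zero_mul, zero_smul] at this; rw [this]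
  | cons p l ih =>
    rw [List.map_cons, List.sum_cons, tc_add_left, tc_smul_left]
    have hp := hl p (by simp)
    refine add_nonneg (mul_nonneg hp.1 ?_) (ih fun p' hp' => hl p' (List.mem_cons_of_mem _ hp'))
    have key := tc_front4_nonneg_all (d := 0) b hp.2 hg hh hgm hhm
    rwa [frontFn_four_zero] at key

/-- ★★★ **Sahi's conjecture `C₃` for every product measure on `{0,1}^4`** (equivalently Kahn's `E₃ ≥ 0` for three increasing
functions of four independent bits): `SahiPositive (coinWeight q) 3` for all `q ∈ [0,1]^4`. [this work] -/
theorem sahiPositive_coinWeight_four (q : Fin 4 → ℝ) (hq : ∀ i, 0 ≤ q i ∧ q i ≤ 1) : SahiPositive (coinWeight q) 3 := by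
  intro F hF hmono
  have e : F = ![F 0, F 1, F 2] := by
    ext i x; fin_cases i <;> rfl
  rw [e]
  exact sahiE_three_coin_nonneg_of_tc hq fun b =>
    tc_four_nonneg b (hF 0) (hF 1) (hF 2) (hmono 0) (hmono 1) (hmono 2)

end Summit.CriticalPhenomena.PercolationContinuityZ3.Theorems.SahiThreeCopy
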